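import Literature.AlgebraicTopology.SingularHomology.OrbitMapTransfer
import HarnessLib

/-!
# The cohomology of a finite quotient is the invariant cohomology: semi-free actions with taut
# fixed locus (Bredon, *Sheaf Theory* II.19.2 — a proved special case)

Topic `Literature/AlgebraicTopology/SingularHomology`. The tree's named fact
`bredon1997_quotient_cohomology_invariants` (Bredon II Thm. 19.2 with III Thm. 1.1; Grothendieck,
Tôhoku V Thm. 5.3.1) asserts: for a finite group `G` acting on a compact Hausdorff locally
contractible `Z` with orbit map `q : Z → Y` onto a Hausdorff locally contractible `Y`,
`q^* : Hⁱ(Y; ℂ) → Hⁱ(Z; ℂ)` is injective with range the `G`-invariant classes. The tree proves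
the FREE case (finite regular coverings, `FiniteDeckCover.map_proj_injective`,
`FiniteDeckCover.mem_range_map_proj_of_invariant`). This file (with `OrbitMapCohomology.lean`,
`OrbitMapTransfer.lean`) PROVES the theorem for **semi-free actions with taut fixed locus**: every
point of `Z` is either fixed by all of `G` or has trivial stabiliser, and the fixed locus `F ⊆ Z`
and its image `q(F) ⊆ Y` are *taut* (carry a `Cech.RetractionNhds` datum — e.g. compact locally
contractible subsets of spaces embedded in some `ℝᵐ` as neighbourhood retracts,
`Cech.RetractionNhds.nonempty_of_locallyContractibleSpace`, Spanier Thm. 6.1.10 / Hatcher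
Thm. A.7, both proved in the tree). This covers every action of a group of order `2`, in particular
the reflection quotients `X_ψ → X_ψ/⟨s⟩` of the Dwork pencil (route `DworkReflectionQuotients`,
crux `ReflectionQuotientDescent`, `Summits/HodgeConjecture`).

The argument avoids sheaf theory, `G`-CW structures and tubular neighbourhoods: with `B = q(F)`
and `U = Y ∖ B`, the action is free over `U`, so `q` is a finite regular covering there (free case);
for EVERY open neighbourhood `W` of `B` the Mayer–Vietoris sequences of `Y = U ∪ W` and
`Z = q⁻¹U ∪ q⁻¹W` are compared, and the missing comparison on `W` is replaced by TAUTNESS — a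
class on `W` dying on `B` dies on a smaller neighbourhood, every class on `B` extends to a
neighbourhood, the same for `F ⊆ Z` where the `q⁻¹W` are cofinal — while on `F` itself
`q : F → B` is a homeomorphism and `G` acts trivially. The five-lemma chase is run by shrinking `W`
finitely many times (`OrbitMapTransfer.lean`); invariants are taken by averaging (`char R = 0`).

* `OrbitMap.actF_eq_self_of_fix`, `OrbitMap.rH_bijective_of_fix` — on a pointwise fixed `F`,
  `G` acts trivially on `H^p_Z(F)` and `q^* : H^p_Y(q(F)) ≅ H^p_Z(F)`;
* `OrbitMap.transfer_subset_of_semifree` — the theorem in the subset model;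
* `OrbitMap.transfer_of_semifree` — **`q^* : Hᵖ(Y; R) → Hᵖ(Z; R)` is injective and every
  `G`-invariant class is a pull-back**, on `singularCohomology`, for a semi-free action with taut
  fixed locus (translation through `H^p_X(univ) ≅ H^p(↥univ) ≅ H^p(X)`);
* `OrbitMap.transfer_of_card_le_two` — the case of a group with at most one non-trivial element.

Everything is proved; no named facts, no instances.

## References

* [Bredon1997] G. E. Bredon, *Sheaf Theory*, 2nd ed., GTM 170 (1997), II Thm. 19.2.
* [HatcherAT2002] A. Hatcher, *Algebraic Topology*, CUP 2002, §3.1 pp. 199–204, §3.G Prop. 3G.1,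
  §1.3 Prop. 1.40.
* [Spanier1981] E. H. Spanier, *Algebraic Topology*, Ch. 6 §1 Thm. 10 and Cor. 11 (tautness).
-/

noncomputable section

-- as in `SubsetCochainsComparisonPull`: chains of the concrete complex are `Finsupp`s up to unfolding
set_option backward.isDefEq.respectTransparency false

open CategoryTheory Limits Set Function
open _root_.Topology

universe u v w

namespace Literature.AlgebraicTopology.SingularHomology

namespace OrbitMap

open subsetCochains

variable {R : Type v} [Field R]

variable {G : Type w} [Group G] {Z Y : Type u} [TopologicalSpace Z] [TopologicalSpace Y]
  [MulAction G Z] [ContinuousConstSMul G Z] (q : C(Z, Y))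
  (horb : ∀ z z' : Z, q z = q z' ↔ ∃ g : G, g • z = z')

/-! ### §6 Semi-free actions: the transfer on the fixed locus is a homeomorphism; translation to
the singular cohomology of `Z` and `Y` -/

section SemiFree

variable [Fintype G] [CompactSpace Z] [T2Space Z] [T2Space Y] [CharZero R]
  (hsurj : Function.Surjective q) {F : Set Z} (hFc : IsClosed F)
  (hfix : ∀ z ∈ F, ∀ g : G, g • z = z)

omit [TopologicalSpace Z] [TopologicalSpace Y] [ContinuousConstSMul G Z] [Fintype G] [CompactSpace Z]
  [T2Space Z] [T2Space Y] [CharZero R] in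
include hfix in
/-- A pointwise fixed set is `G`-stable. [cite: Bredon1997, II Thm. 19.2] -/
theorem stable_of_fix (g : G) (z : Z) (hz : z ∈ F) : g • z ∈ F := by
  rw [hfix z hz g]; exact hz

omit [Fintype G] [CompactSpace Z] [T2Space Z] [T2Space Y] [CharZero R] in
include hfix in
/-- **On a pointwise fixed `F` the group acts trivially on `H^p_Z(F)`** (the restriction of `g` to
`↥F` is the identity; comparison `H^p_Z(F) ≅ H^p(↥F)`). [cite: Bredon1997, II Thm. 19.2] -/
theorem actF_eq_self_of_fix (g : G) (p : ℕ) (x : (subsetCochains R (SimplexSpan.coefR R) F).homology p) :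
    actF (R := R) (stable_of_fix hfix) g p x = x := by
  have hid : restrictMap (smulMap (Z := Z) g) (fun z hz ↦ stable_of_fix hfix g z hz) =
      ContinuousMap.id (↥F) := by
    ext z
    exact hfix z.1 z.2 g
  apply ((forget (ModuleCat R)).mapIso (homologyIsoSingularCohomology R F p)).toEquiv.injective
  change (homologyIsoSingularCohomology R F p).hom (pullH (smulMap g) _ p x) =
    (homologyIsoSingularCohomology R F p).hom x
  rw [homologyIsoSingularCohomology_hom_pullH, hid, singularCohomology.map_id, ModuleCat.id_apply]

omit [Fintype G] [T2Space Z] [CharZero R] in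
omit [ContinuousConstSMul G Z] [Fintype G] [T2Space Z] [CharZero R] in
include horb hFc hfix in
/-- **On a pointwise fixed `F`, `q : F → q(F)` is a homeomorphism** (a continuous bijection from a
compact space to a Hausdorff one; injective because the fibres of `q` are orbits, which are points
on `F`): there is `e : ↥F ≃ₜ ↥q(F)` whose underlying map is the restriction of `q`.
[cite: Bredon1997, II Thm. 19.2] -/
theorem exists_homeomorph_of_fix :
    ∃ e : ↥F ≃ₜ ↥(q '' F), (e : C(↥F, ↥(q '' F))) = restrictMap q (Set.mapsTo_image q F) := by
  haveI : CompactSpace ↥F := isCompact_iff_compactSpace.1 hFc.isCompact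
  have hinj : Function.Injective (restrictMap q (Set.mapsTo_image q F)) := by
    rintro ⟨z, hz⟩ ⟨z', hz'⟩ h
    obtain ⟨g, hg⟩ := (horb z z').1 (congrArg Subtype.val h)
    exact Subtype.ext (show z = z' by rw [← hg, hfix z hz g])
  have hsur : Function.Surjective (restrictMap q (Set.mapsTo_image q F)) := by
    rintro ⟨_, z, hz, rfl⟩
    exact ⟨⟨z, hz⟩, rfl⟩
  exact ⟨Continuous.homeoOfEquivCompactToT2 (f := Equiv.ofBijective _ ⟨hinj, hsur⟩)
    (restrictMap q (Set.mapsTo_image q F)).continuous, rfl⟩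

omit [ContinuousConstSMul G Z] [Fintype G] [T2Space Z] [CharZero R] in
include horb hFc hfix in
/-- `↥q(F)` is locally contractible when `↥F` is (they are homeomorphic). [cite: Bredon1997, II Thm. 19.2] -/
theorem locallyContractibleSpace_image_of_fix (hF : LocallyContractibleSpace ↥F) :
    LocallyContractibleSpace ↥(q '' F) := by
  obtain ⟨e, -⟩ := exists_homeomorph_of_fix q horb hFc hfix
  exact Literature.AlgebraicTopology.Homotopy.locallyContractibleSpace_of_homeomorph e hF

omit [ContinuousConstSMul G Z] [Fintype G] [T2Space Z] [CharZero R] in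
include horb hFc hfix in
/-- **On a pointwise fixed `F`, `q^* : H^p_Y(q(F)) → H^p_Z(F)` is bijective** (`q : F ≃ q(F)`).
[cite: Bredon1997, II Thm. 19.2] -/
theorem rH_bijective_of_fix (p : ℕ) : Function.Bijective (rH (R := R) q F p) := by
  obtain ⟨e, he⟩ := exists_homeomorph_of_fix q horb hFc hfix
  rw [rH, pullH_bijective_iff, ← he]
  exact (ConcreteCategory.isIso_iff_bijective (singularCohomology.mapIso R R e p).hom).1 inferInstance

variable (hfree : ∀ z : Z, z ∉ F → ∀ g : G, g • z = z → g = 1)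
  (TF : Cech.RetractionNhds F) (TB : Cech.RetractionNhds (q '' F))

include horb hsurj hFc hfix hfree TF TB in
/-- **The transfer for a semi-free action with taut fixed locus, subset model**: `q^*` is injective
on `H^p_Y(Y)` and every invariant class of `H^p_Z(Z)` is in its range. [cite: Bredon1997, II Thm. 19.2] -/
theorem transfer_subset_of_semifree (p : ℕ) :
    Function.Injective (qH (R := R) q (univ : Set Y) p) ∧
      ∀ z : (subsetCochains R (SimplexSpan.coefR R) (q ⁻¹' (univ : Set Y))).homology p,
        (∀ g : G, act q horb (univ : Set Y) g p z = z) → ∃ y, qH (R := R) q (univ : Set Y) p y = z := by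
  have hrinj : ∀ p, Function.Injective (rH (R := R) q F p) :=
    fun p ↦ (rH_bijective_of_fix q horb hFc hfix p).1
  have hrsurj : ∀ (p : ℕ) (x : (subsetCochains R (SimplexSpan.coefR R) F).homology p),
      (∀ g : G, actF (R := R) (stable_of_fix hfix) g p x = x) → ∃ y, rH (R := R) q F p y = x :=
    fun p x _ ↦ (rH_bijective_of_fix q horb hFc hfix p).2 x
  exact ⟨qH_univ_injective q horb hsurj hFc (stable_of_fix hfix) hfree TF TB hrinj hrsurj p,
    exists_qH_univ_eq q horb hsurj hFc (stable_of_fix hfix) hfree TF TB hrsurj p⟩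

/-! #### Translation to `singularCohomology` of `Z` and `Y` -/

omit [MulAction G Z] [ContinuousConstSMul G Z] [Fintype G] [CompactSpace Z] [T2Space Z] [T2Space Y]
  [CharZero R] in
/-- The restriction `↥univ → ↥univ` of a map `f : X → X'` is `f` conjugated by the homeomorphisms
`↥univ ≃ X`. [cite: HatcherAT2002, §3.1 p. 199] -/
theorem restrictMap_univ_eq {X X' : Type u} [TopologicalSpace X] [TopologicalSpace X'] (f : C(X, X')) :
    restrictMap f (Set.mapsTo_univ f univ) =
      ((Homeomorph.Set.univ X').symm : C(X', ↥(univ : Set X'))).comp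
        (f.comp (Homeomorph.Set.univ X : C(↥(univ : Set X), X))) :=
  ContinuousMap.ext fun _ ↦ rfl

omit [MulAction G Z] [ContinuousConstSMul G Z] [Fintype G] [CompactSpace Z] [T2Space Z] [T2Space Y]
  [CharZero R] in
/-- `e⁻¹^* (e^* c) = c` for a homeomorphism `e`. [cite: HatcherAT2002, §3.1 p. 199] -/
theorem map_symm_map {X X' : Type u} [TopologicalSpace X] [TopologicalSpace X'] (e : X ≃ₜ X') (p : ℕ)
    (c : singularCohomology R R X' p) :
    singularCohomology.map R R (e.symm : C(X', X)) p (singularCohomology.map R R (e : C(X, X')) p c) = c := by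
  rw [← ModuleCat.comp_apply, ← singularCohomology.map_comp]
  have : (e : C(X, X')).comp (e.symm : C(X', X)) = ContinuousMap.id X' := by
    ext x; exact e.apply_symm_apply x
  rw [this, singularCohomology.map_id, ModuleCat.id_apply]

omit [MulAction G Z] [ContinuousConstSMul G Z] [Fintype G] [CompactSpace Z] [T2Space Z] [T2Space Y]
  [CharZero R] in
/-- `e^* (e⁻¹^* c) = c` for a homeomorphism `e`. [cite: HatcherAT2002, §3.1 p. 199] -/
theorem map_map_symm {X X' : Type u} [TopologicalSpace X] [TopologicalSpace X'] (e : X ≃ₜ X') (p : ℕ)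
    (c : singularCohomology R R X p) :
    singularCohomology.map R R (e : C(X, X')) p (singularCohomology.map R R (e.symm : C(X', X)) p c) = c := by
  rw [← ModuleCat.comp_apply, ← singularCohomology.map_comp]
  have : (e.symm : C(X', X)).comp (e : C(X, X')) = ContinuousMap.id X := by
    ext x; exact e.symm_apply_apply x
  rw [this, singularCohomology.map_id, ModuleCat.id_apply]

omit [MulAction G Z] [ContinuousConstSMul G Z] [Fintype G] [CompactSpace Z] [T2Space Z] [T2Space Y]
  [CharZero R] in
/-- **The comparison square for a map `f : X → X'`**: under `H^p_{X'}(univ) ≅ H^p(↥univ)` and the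
homeomorphisms `↥univ ≃ X`, `↥univ ≃ X'`, the pull-back `pullH f` on `univ` is
`e_X^* ∘ f^* ∘ (e_{X'}⁻¹)^*`. [cite: HatcherAT2002, §3.1 p. 199] -/
theorem iso_pullH_univ {X X' : Type u} [TopologicalSpace X] [TopologicalSpace X'] (f : C(X, X')) (p : ℕ)
    (y : (subsetCochains R (SimplexSpan.coefR R) (univ : Set X')).homology p) :
    (homologyIsoSingularCohomology R (univ : Set X) p).hom (pullH (N := SimplexSpan.coefR R) f (Set.mapsTo_univ f univ) p y) =
      singularCohomology.map R R (Homeomorph.Set.univ X : C(↥(univ : Set X), X)) p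
        (singularCohomology.map R R f p
          (singularCohomology.map R R ((Homeomorph.Set.univ X').symm : C(X', ↥(univ : Set X'))) p
            ((homologyIsoSingularCohomology R (univ : Set X') p).hom y))) := by
  rw [homologyIsoSingularCohomology_hom_pullH, restrictMap_univ_eq, singularCohomology.map_comp,
    singularCohomology.map_comp, ModuleCat.comp_apply, ModuleCat.comp_apply]

include horb hsurj hFc hfix hfree TF TB in
/-- **Bredon II.19.2 for semi-free actions with taut fixed locus.** Let the finite group `G` act
continuously on the compact Hausdorff space `Z`, let `q : Z → Y` be a continuous surjection onto a
Hausdorff space whose fibres are the `G`-orbits, and suppose the action is SEMI-FREE with fixed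
locus `F`: `F` is closed, every point of `F` is fixed by all of `G`, every point off `F` has trivial
stabiliser; suppose `F ⊆ Z` and `q(F) ⊆ Y` are taut (`Cech.RetractionNhds`, e.g. compact locally
contractible subsets of Euclidean neighbourhood retracts). Then for every field `R` of
characteristic zero and every `p`, `q^* : Hᵖ(Y; R) → Hᵖ(Z; R)` is injective and every
`G`-invariant class is in its range: `Hᵖ(Y; R) ≅ Hᵖ(Z; R)^G`. [cite: Bredon1997, II Thm. 19.2] -/
theorem transfer_of_semifree (p : ℕ) :
    Function.Injective (singularCohomology.map R R q p) ∧
      ∀ c : singularCohomology R R Z p,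
        (∀ g : G, singularCohomology.map R R
          (⟨fun z ↦ g • z, continuous_const_smul g⟩ : C(Z, Z)) p c = c) →
        c ∈ Set.range (singularCohomology.map R R q p) := by
  obtain ⟨hinj, hsur⟩ := transfer_subset_of_semifree (R := R) q horb hsurj hFc hfix hfree TF TB p
  set eZ := Homeomorph.Set.univ Z with heZ
  set eY := Homeomorph.Set.univ Y with heY
  set iZ := homologyIsoSingularCohomology R (univ : Set Z) p with hiZ
  set iY := homologyIsoSingularCohomology R (univ : Set Y) p with hiY
  have hiZinj : Function.Injective iZ.hom := ((forget (ModuleCat R)).mapIso iZ).toEquiv.injective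
  have hiYsur : Function.Surjective iY.hom := ((forget (ModuleCat R)).mapIso iY).toEquiv.surjective
  have heZinj : Function.Injective (singularCohomology.map R R (eZ : C(↥(univ : Set Z), Z)) p) :=
    ((ConcreteCategory.isIso_iff_bijective (singularCohomology.mapIso R R eZ p).hom).1 inferInstance).1
  -- the comparison square for `q`
  have hsq : ∀ y : (subsetCochains R (SimplexSpan.coefR R) (univ : Set Y)).homology p,
      iZ.hom (qH (R := R) q univ p y) = singularCohomology.map R R (eZ : C(↥(univ : Set Z), Z)) p
        (singularCohomology.map R R q p (singularCohomology.map R R (eY.symm : C(Y, ↥(univ : Set Y))) p (iY.hom y))) :=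
    fun y ↦ iso_pullH_univ (R := R) q p y
  refine ⟨fun c₁ c₂ h ↦ ?_, fun c hc ↦ ?_⟩
  · -- injectivity
    obtain ⟨y₁, hy₁⟩ := hiYsur (singularCohomology.map R R (eY : C(↥(univ : Set Y), Y)) p c₁)
    obtain ⟨y₂, hy₂⟩ := hiYsur (singularCohomology.map R R (eY : C(↥(univ : Set Y), Y)) p c₂)
    have h1 : iZ.hom (qH (R := R) q univ p y₁) = iZ.hom (qH (R := R) q univ p y₂) := by
      rw [hsq, hsq, hy₁, hy₂, map_symm_map, map_symm_map, h]
    have h2 : y₁ = y₂ := hinj (hiZinj h1)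
    have h3 : singularCohomology.map R R (eY : C(↥(univ : Set Y), Y)) p c₁ =
        singularCohomology.map R R (eY : C(↥(univ : Set Y), Y)) p c₂ := by rw [← hy₁, ← hy₂, h2]
    rw [← map_symm_map (R := R) eY p c₁, ← map_symm_map (R := R) eY p c₂, h3]
  · -- invariants are pull-backs
    set x := singularCohomology.map R R (eZ : C(↥(univ : Set Z), Z)) p c with hx
    obtain ⟨z, hz⟩ : ∃ z, iZ.hom z = x := ((forget (ModuleCat R)).mapIso iZ).toEquiv.surjective x
    have hzinv : ∀ g : G, act q horb (univ : Set Y) g p z = z := by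
      intro g
      apply hiZinj
      change iZ.hom (pullH (smulMap g) _ p z) = iZ.hom z
      rw [hiZ, homologyIsoSingularCohomology_hom_pullH, restrictMap_univ_eq, singularCohomology.map_comp,
        singularCohomology.map_comp, ModuleCat.comp_apply, ModuleCat.comp_apply, ← hiZ, hz, hx,
        map_symm_map]
      exact congrArg _ (hc g)
    obtain ⟨y, hy⟩ := hsur z hzinv
    refine ⟨singularCohomology.map R R (eY.symm : C(Y, ↥(univ : Set Y))) p (iY.hom y), heZinj ?_⟩
    rw [← hx, ← hz, ← hy, hsq]

include horb hsurj in
/-- **Every action of a group with at most one non-trivial element is semi-free**, so: for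
`σ ∈ G` with `∀ g, g = 1 ∨ g = σ` (e.g. `G` of order `2`), `Z` compact Hausdorff, `q : Z → Y`
the orbit map onto a Hausdorff `Y`, and the fixed set `F = {z | σ • z = z}` and its image `q(F)`
taut, `q^* : Hᵖ(Y; R) → Hᵖ(Z; R)` is injective with range the invariant classes — the case of
the branched double covers `X → X/⟨s⟩` by an involution. [cite: Bredon1997, II Thm. 19.2] -/
theorem transfer_of_card_le_two (σ : G) (hG : ∀ g : G, g = 1 ∨ g = σ)
    (TF : Cech.RetractionNhds {z : Z | σ • z = z}) (TB : Cech.RetractionNhds (q '' {z : Z | σ • z = z}))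
    (p : ℕ) :
    Function.Injective (singularCohomology.map R R q p) ∧
      ∀ c : singularCohomology R R Z p,
        (∀ g : G, singularCohomology.map R R
          (⟨fun z ↦ g • z, continuous_const_smul g⟩ : C(Z, Z)) p c = c) →
        c ∈ Set.range (singularCohomology.map R R q p) := by
  have hFc : IsClosed {z : Z | σ • z = z} :=
    isClosed_eq (continuous_const_smul σ) continuous_id
  have hfix : ∀ z ∈ {z : Z | σ • z = z}, ∀ g : G, g • z = z := by
    intro z hz g
    rcases hG g with rfl | rfl
    · exact one_smul G z
    · exact hz
  have hfree : ∀ z : Z, z ∉ {z : Z | σ • z = z} → ∀ g : G, g • z = z → g = 1 := by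
    intro z hz g hg
    rcases hG g with rfl | rfl
    · rfl
    · exact absurd hg hz
  exact transfer_of_semifree (R := R) q horb hsurj hFc hfix hfree TF TB p

end SemiFree

end OrbitMap

end Literature.AlgebraicTopology.SingularHomology
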